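import Mathlib.LinearAlgebra.Matrix.Permutation
import Literature.MathematicalPhysics.QuantumLattice.GrassmannIntegralSubstitution
import Literature.MathematicalPhysics.QuantumLattice.GrassmannRelabelling

/-!
# `SlabToTorus` (stmt-QuantumFields-10529), part 1: relabelling the quark generators `ψ̄ᵢ, ψᵢ`

Helper file for the route item `CentreStabilisedCircle.SlabToTorus` (identification of the
centre-stabilised circle functional at `N_t = N_s`, `h = θ = 0` with the tree's torus functional
`qcdTorusExpect`). The two functionals enumerate their quark variables along two different
`Fintype.equivFin`s, so the Grassmann algebras `⋀(ι ⊕ₗ ι → ℂ)` and `⋀(ι' ⊕ₗ ι' → ℂ)` have to be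
compared along the "doubled" bijection `ψ̄ᵢ ↦ ψ̄_{e i}`, `ψᵢ ↦ ψ_{e i}` of a bijection `e : ι ≃ ι'`,
realised (as in `GrassmannRelabelling.lean`) by
`ExteriorAlgebra.map (LinearMap.funLeft R R (dbl e).symm)` with
`dbl e = toLex.symm.trans ((Equiv.sumCongr e e).trans toLex) : ι ⊕ₗ ι ≃ ι' ⊕ₗ ι'` (written out, no
new definition). Proved here:

* `map_funLeft_dbl_psiBar` / `map_funLeft_dbl_psi` — the relabelling acts by `ψ̄ᵢ ↦ ψ̄_{e i}`,
  `ψᵢ ↦ ψ_{e i}`;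
* `map_funLeft_dbl_quadratic` — `ψ̄ A ψ ↦ ψ̄' (A ∘ (e⁻¹ × e⁻¹)) ψ'` (`Matrix.reindex e e A`);
* `det_funLeft_perm` — the substitution `v ↦ v ∘ p` of a permutation `p` has determinant `sign p`;
* `berezin_map_funLeft_dbl` — for `e : Fin n₁ ≃ Fin n₂` (so `n₁ = n₂`) the Berezin integrals over
  all generators agree: the doubled permutation has sign `(sign e)² = 1`, so Berezin's
  change-of-variables formula (`GrassmannAlgebra.berezin_map`) has unit Jacobian.

All statements are routine ("folklore"; Berezin 1966, Ch. I §3).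
-/

namespace Summit.QuantumFields.QCD.Theorems.CentreStabilisedCircleSlabToTorus

open Literature.MathematicalPhysics.QuantumLattice GrassmannAlgebra

variable (R : Type*) [CommRing R] {ι ι' : Type*}

/-- The doubled bijection sends `ψ̄ᵢ`'s label to `ψ̄_{e i}`'s label. [folklore] -/
theorem dbl_toLex_inl (e : ι ≃ ι') (i : ι) :
    (toLex.symm.trans ((Equiv.sumCongr e e).trans toLex)) (toLex (Sum.inl i) : ι ⊕ₗ ι) =
      (toLex (Sum.inl (e i)) : ι' ⊕ₗ ι') := rfl

/-- The doubled bijection sends `ψᵢ`'s label to `ψ_{e i}`'s label. [folklore] -/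
theorem dbl_toLex_inr (e : ι ≃ ι') (i : ι) :
    (toLex.symm.trans ((Equiv.sumCongr e e).trans toLex)) (toLex (Sum.inr i) : ι ⊕ₗ ι) =
      (toLex (Sum.inr (e i)) : ι' ⊕ₗ ι') := rfl

/-- **The relabelling acts by `ψ̄ᵢ ↦ ψ̄_{e i}`.** [folklore] -/
theorem map_funLeft_dbl_psiBar [DecidableEq ι] [DecidableEq ι'] (e : ι ≃ ι') (i : ι) :
    ExteriorAlgebra.map (LinearMap.funLeft R R (toLex.symm.trans ((Equiv.sumCongr e e).trans
      (toLex : ι' ⊕ ι' ≃ ι' ⊕ₗ ι'))).symm) (psiBar R i) = psiBar R (e i) := by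
  rw [psiBar, map_funLeft_gen]
  rfl

/-- **The relabelling acts by `ψᵢ ↦ ψ_{e i}`.** [folklore] -/
theorem map_funLeft_dbl_psi [DecidableEq ι] [DecidableEq ι'] (e : ι ≃ ι') (i : ι) :
    ExteriorAlgebra.map (LinearMap.funLeft R R (toLex.symm.trans ((Equiv.sumCongr e e).trans
      (toLex : ι' ⊕ ι' ≃ ι' ⊕ₗ ι'))).symm) (psi R i) = psi R (e i) := by
  rw [psi, map_funLeft_gen]
  rfl

/-- **The quadratic action transforms by relabelling the matrix**: `ψ̄ A ψ ↦ ψ̄' (A ∘ (e⁻¹ × e⁻¹)) ψ'`,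
i.e. `quadratic (Matrix.reindex e e A)`. [folklore] -/
theorem map_funLeft_dbl_quadratic [Fintype ι] [Fintype ι'] [DecidableEq ι] [DecidableEq ι']
    (e : ι ≃ ι') (A : Matrix ι ι R) :
    ExteriorAlgebra.map (LinearMap.funLeft R R (toLex.symm.trans ((Equiv.sumCongr e e).trans
      (toLex : ι' ⊕ ι' ≃ ι' ⊕ₗ ι'))).symm) (quadratic R A) = quadratic R (Matrix.reindex e e A) := by
  simp only [quadratic, map_sum, map_smul, map_mul, map_funLeft_dbl_psiBar, map_funLeft_dbl_psi]
  symm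
  rw [← e.sum_comp]
  refine Finset.sum_congr rfl fun i _ => ?_
  rw [← e.sum_comp]
  refine Finset.sum_congr rfl fun j _ => ?_
  rw [Matrix.reindex_apply, Matrix.submatrix_apply, Equiv.symm_apply_apply, Equiv.symm_apply_apply]

/-- The substitution `v ↦ v ∘ p` of the generator space along a permutation `p` of the labels has
determinant `sign p` (its matrix is the permutation matrix of `p`). [folklore] -/
theorem det_funLeft_perm {J : Type*} [Fintype J] [DecidableEq J] (p : Equiv.Perm J) :
    LinearMap.det (LinearMap.funLeft R R p) = ((Equiv.Perm.sign p : ℤˣ) : ℤ) := by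
  rw [← LinearMap.det_toMatrix', ← Matrix.det_permutation]
  congr 1
  ext i j
  rw [LinearMap.toMatrix'_apply, LinearMap.funLeft_apply, Equiv.Perm.permMatrix,
    PEquiv.toMatrix_toPEquiv_apply, Pi.single_apply, Pi.single_apply]
  exact if_congr eq_comm rfl rfl

/-- **The Berezin integral is invariant under the doubled relabelling** `ψ̄ᵢ ↦ ψ̄_{e i}`,
`ψᵢ ↦ ψ_{e i}` along any bijection `e : Fin n₁ ≃ Fin n₂` (both Grassmann algebras ordered `ψ̄`
before `ψ`, each block by the order of `Fin`): transporting along `n₁ = n₂`, the doubled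
permutation `inl i ↦ inl (e i)`, `inr i ↦ inr (e i)` of `Fin n ⊕ₗ Fin n` has sign `(sign e)² = 1`, so
Berezin's change-of-variables formula has Jacobian `1`. [folklore] -/
theorem berezin_map_funLeft_dbl {n₁ n₂ : ℕ} (h : n₁ = n₂) (e : Fin n₁ ≃ Fin n₂)
    (x : GrassmannAlgebra R (Fin n₁ ⊕ₗ Fin n₁)) :
    berezin R (Fin n₂ ⊕ₗ Fin n₂) (ExteriorAlgebra.map (LinearMap.funLeft R R
      (toLex.symm.trans ((Equiv.sumCongr e e).trans (toLex : Fin n₂ ⊕ Fin n₂ ≃ Fin n₂ ⊕ₗ Fin n₂))).symm) x) =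
      berezin R (Fin n₁ ⊕ₗ Fin n₁) x := by
  subst h
  refine berezin_map_of_det_eq_one R ?_ x
  rw [det_funLeft_perm, Equiv.Perm.sign_symm,
    show (toLex.symm.trans ((Equiv.sumCongr e e).trans (toLex : Fin n₁ ⊕ Fin n₁ ≃ Fin n₁ ⊕ₗ Fin n₁))) =
      Equiv.permCongr toLex (Equiv.sumCongr e e) from rfl,
    Equiv.Perm.sign_permCongr, Equiv.Perm.sign_sumCongr, Int.units_mul_self, Units.val_one, Int.cast_one]

end Summit.QuantumFields.QCD.Theorems.CentreStabilisedCircleSlabToTorus
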